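import Mathlib

/-!
# Rank-one perturbations: eigenvalues as zeros of a scalar loop function (solo-blind kernel #170)

Finite-dimensional skeleton of step (M2)(ii) of the 'B9' certificate (PLAN §101): after the exact
linear decoupling, the complement generator is a RANK-ONE perturbation `D - V g` of the deleted
chain `D`, and a number `z` outside the spectrum of the unperturbed part is a multiplier of the
perturbed one iff the SCALAR loop quantity `g (z - D)⁻¹ V` equals `1` (periodic case: iff the scalar
Fredholm operator `1 + 𝒦_z` is singular).  Here, for a square matrix `A` over a field, vectors
`u v`, and `z` with `det (z•1 - A) ≠ 0`:
`det (z•1 - (A + u vᵀ)) = det (z•1 - A) * (1 - vᵀ (z•1 - A)⁻¹ u)` (matrix determinant lemma), hence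
`z` is an eigenvalue of `A + u vᵀ` iff `vᵀ (z•1 - A)⁻¹ u = 1`.
-/

namespace Summit.AnomalousDissipation.AnomalousDissipation.Theorems

open Matrix

/-- A `Unit × Unit` product `row v * B * col u` is the `1 × 1` matrix with entry `v ⬝ᵥ (B *ᵥ u)`. -/
theorem soloBlind_replicateRow_mul_mul_replicateCol {𝕜 n : Type*} [CommRing 𝕜] [Fintype n]
    (B : Matrix n n 𝕜) (u v : n → 𝕜) :
    replicateRow Unit v * B * replicateCol Unit u = Matrix.of (fun _ _ => v ⬝ᵥ (B *ᵥ u)) := by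
  ext i j
  simp only [Matrix.mul_apply, Matrix.replicateRow_apply, Matrix.replicateCol_apply,
    Matrix.of_apply, dotProduct, Matrix.mulVec, Finset.sum_mul, Finset.mul_sum]
  rw [Finset.sum_comm]
  exact Finset.sum_congr rfl fun x _ => Finset.sum_congr rfl fun y _ => by ring

/-- **Matrix determinant lemma in resolvent form.** If `det (z•1 - A)` is a unit then
`det (z•1 - (A + col u * row v)) = det (z•1 - A) * (1 - v ⬝ᵥ ((z•1 - A)⁻¹ *ᵥ u))`. -/
theorem soloBlind_det_sub_rankOne {𝕜 n : Type*} [Field 𝕜] [Fintype n] [DecidableEq n]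
    (A : Matrix n n 𝕜) (u v : n → 𝕜) (z : 𝕜)
    (hz : IsUnit (z • (1 : Matrix n n 𝕜) - A).det) :
    (z • (1 : Matrix n n 𝕜) - (A + replicateCol Unit u * replicateRow Unit v)).det
      = (z • (1 : Matrix n n 𝕜) - A).det * (1 - v ⬝ᵥ ((z • (1 : Matrix n n 𝕜) - A)⁻¹ *ᵥ u)) := by
  have hcol : replicateCol Unit (-u) = -replicateCol Unit u := by
    ext i j; simp
  have hsplit : z • (1 : Matrix n n 𝕜) - (A + replicateCol Unit u * replicateRow Unit v)
      = (z • (1 : Matrix n n 𝕜) - A) + replicateCol Unit (-u) * replicateRow Unit v := by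
    rw [hcol, Matrix.neg_mul]; abel
  have h1x1 : ∀ s : 𝕜, (1 + Matrix.of (fun (_ : Unit) (_ : Unit) => s)).det = 1 + s := by
    intro s; rw [Matrix.det_unique]; simp
  rw [hsplit, Matrix.det_add_replicateCol_mul_replicateRow hz,
    soloBlind_replicateRow_mul_mul_replicateCol, h1x1]
  simp only [Matrix.mulVec_neg, dotProduct_neg]
  ring

/-- **Eigenvalues of a rank-one perturbation are the zeros of the scalar loop function.** For `z`
outside the spectrum of `A` (i.e. `det (z•1 - A) ≠ 0`), `z` is an eigenvalue of `A + col u * row v`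
(there is `w ≠ 0` with `(z•1 - (A + u vᵀ)) w = 0`) iff `v ⬝ᵥ ((z•1 - A)⁻¹ *ᵥ u) = 1`. -/
theorem soloBlind_rankOne_eigenvalue_iff {𝕜 n : Type*} [Field 𝕜] [Fintype n] [DecidableEq n]
    (A : Matrix n n 𝕜) (u v : n → 𝕜) (z : 𝕜)
    (hz : (z • (1 : Matrix n n 𝕜) - A).det ≠ 0) :
    (∃ w : n → 𝕜, w ≠ 0 ∧
        (z • (1 : Matrix n n 𝕜) - (A + replicateCol Unit u * replicateRow Unit v)) *ᵥ w = 0)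
      ↔ v ⬝ᵥ ((z • (1 : Matrix n n 𝕜) - A)⁻¹ *ᵥ u) = 1 := by
  have hdet := soloBlind_det_sub_rankOne A u v z (isUnit_iff_ne_zero.mpr hz)
  constructor
  · rintro ⟨w, hw0, hw⟩
    have hd : (z • (1 : Matrix n n 𝕜) - (A + replicateCol Unit u * replicateRow Unit v)).det = 0 :=
      Matrix.exists_mulVec_eq_zero_iff.mp ⟨w, hw0, hw⟩
    rw [hdet] at hd
    rcases mul_eq_zero.mp hd with h | h
    · exact absurd h hz
    · exact (sub_eq_zero.mp h).symm
  · intro h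
    have hd : (z • (1 : Matrix n n 𝕜) - (A + replicateCol Unit u * replicateRow Unit v)).det = 0 := by
      rw [hdet, h, sub_self, mul_zero]
    obtain ⟨w, hw0, hw⟩ := Matrix.exists_mulVec_eq_zero_iff.mpr hd
    exact ⟨w, hw0, hw⟩

/-- Contrapositive used by the certificate: if the scalar loop value is NOT `1` for every `z` in a
region avoiding the spectrum of `A`, the rank-one perturbation has no eigenvalue there. -/
theorem soloBlind_rankOne_no_eigenvalue {𝕜 n : Type*} [Field 𝕜] [Fintype n] [DecidableEq n]
    (A : Matrix n n 𝕜) (u v : n → 𝕜) (S : Set 𝕜)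
    (hS : ∀ z ∈ S, (z • (1 : Matrix n n 𝕜) - A).det ≠ 0)
    (hloop : ∀ z ∈ S, v ⬝ᵥ ((z • (1 : Matrix n n 𝕜) - A)⁻¹ *ᵥ u) ≠ 1) :
    ∀ z ∈ S, ∀ w : n → 𝕜,
      (z • (1 : Matrix n n 𝕜) - (A + replicateCol Unit u * replicateRow Unit v)) *ᵥ w = 0 → w = 0 := by
  intro z hzS w hw
  by_contra hw0
  exact hloop z hzS ((soloBlind_rankOne_eigenvalue_iff A u v z (hS z hzS)).mp ⟨w, hw0, hw⟩)

end Summit.AnomalousDissipation.AnomalousDissipation.Theorems
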